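import Literature.Geometry.Lorentzian.CoordRoundDefectEvolution
import Literature.Geometry.Riemannian.CurvatureDerivativeNormSq
import Literature.Geometry.Riemannian.RicciFlowScalarCurvatureEvolution
import Literature.Geometry.Riemannian.CurvatureNormSq
import Summits.SmoothPoincare4.SmoothPoincare4.Theorems.EntropyRungChangGurskyYangStubGradientEstimatesEvolution
import HarnessLib

/-!
# The evolution inequality of the round defect along a Ricci flow on a closed 4-manifold
(stub `stub_smoothRoundLimit`, piece S2 `helper_roundDefect_evolution`, of line
`margerin-cone-hamilton-rails`, crux `EntropyRung.ChangGurskyYang`, item stmt-SmoothPoincare4-10834)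

Hamilton 1982, §17 (Thm. 17.6): along a Ricci flow `g(t)` on a closed manifold with singular time
`T`, the rescaled metrics `g(t)/(T − t)` become round, and the squared norm of the **round defect
tensor** `Rm − (T − t)⁻¹ (g ⊙ g)/6` (dimension `4`; in terms of `Q = |Rm|²`, `R` the scalar
curvature and `h = T − t` it is `P = Q − 2R/(3h) + 2/(3h²) ≥ 0`) satisfies the heat inequality
`∂ₜP ≤ ΔP − 2|∇Rm|² + C (Q + h⁻²) √P + C √Q P` — the reaction term vanishes to first order at
the round tensor. This file transports the landed coordinate inequality
`MetricCoord.IsMetricFamilyOn.derivWithin_tnormSq_roundDefect_le`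
(`Literature/Geometry/Lorentzian/CoordRoundDefectEvolution.lean`, with `a(t) = (6(T − t))⁻¹`) to a
Ricci flow `(g, cov)` on `[0, T)` on a closed smooth 4-manifold, exactly as Topping's (3.3.4) is
transported in `CurvatureDerivativeNormSq.lean`: the flow read in the chart at `z₀` is a
coordinate Ricci flow (`IsRicciFlow.isMetricFamilyOn_chartRep_of`, `tDeriv_chartRep_eq_of`), the
dictionary `|Rm − a g ⊙ g|² = Q − 4aR + 24a²` (`tnormSq_rm4_sub_smul_ggKN`), `tnormSq rm4 ↔ |Rm|²`
(`tnormSq_rm4_eq_rmNormSqAt`, `curvNormSqWith_chartInv_eq`), `scalAt ↔ R`, `curvD 1 ↔ |∇Rm|²`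
(`curvDerivNormSq_eq_chart`) and `lapAt ↔ Δ` (`dalembertian_comap`) identifies every term, and
finitely many charts cover the compact manifold (`helper_roundDefect_evolution`, the registered
statement). In the manifold vocabulary `Q = curvNormSqWith (cov t)`, `R = scalarCurvatureWith (cov t)`,
`|∇Rm|² = curvDerivNormSq (𝓡 4) g 1`, `Δ = laplaceBeltrami`.

Everything here is proved; no definition and no named fact is introduced.

## References

* R. S. Hamilton, *Three-manifolds with positive Ricci curvature*, J. Differential Geom. 17 (1982)
  255–306, §17, Lemma 17.5, Thm. 17.6. [Hamilton1982]
* P. Topping, *Lectures on the Ricci flow*, LMS Lecture Note Series 325, CUP 2006, §1.2.3,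
  Prop. 2.5.1, Prop. 3.2.10, §3.3. [Topping2006]
-/

noncomputable section

-- every `Summit.SmoothPoincare4.SmoothPoincare4.…` name repeats the summit = sub-problem segment (D-0017 layout)
set_option linter.dupNamespace false
-- nested operator spaces of metric components (`E →L E →L ℝ` and their derivatives)
set_option maxSynthPendingDepth 3

open Set Function Filter Module
open scoped Manifold ContDiff Topology

namespace Summit.SmoothPoincare4.SmoothPoincare4.Theorems.MargerinRails

open Literature.Geometry.Riemannian
open Literature.Geometry.Lorentzian Literature.Geometry.Lorentzian.PseudoRiemannianMetric
open Literature.Geometry.Lorentzian.MetricCoord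

section Manifold

variable {M : Type*} [TopologicalSpace M] [ChartedSpace (EuclideanSpace ℝ (Fin 4)) M]
  [IsManifold (𝓡 4) ∞ M]
  {g : ℝ → PseudoRiemannianMetric (𝓡 4) ∞ (EuclideanSpace ℝ (Fin 4)) (TangentSpace (𝓡 4) : M → Type _)}
  {cov : ℝ → CovariantDerivative (𝓡 4) (EuclideanSpace ℝ (Fin 4)) (TangentSpace (𝓡 4) : M → Type _)}
  {T : ℝ}

/-- **The scalar curvature of the flow read in the chart** on a general time set:
`scalAt (G s) u = R(g s, cov s)(Φ u)` for the Levi-Civita witness `cov s` (the proof of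
`IsRicciFlow.scalAt_chartRep_eq`, which is stated for `[0, T]`). [cite: Topping2006, Prop. 2.5.4] -/
theorem scalAt_chartRep_eq_of {S : Set ℝ} (hflow : IsRicciFlow g cov S) (x₀ : M) {s : ℝ} (hs : s ∈ S)
    (u : chartTarget (𝓡 4) x₀) :
    scalAt (chartRep (𝓡 4) g x₀ s) u = (g s).scalarCurvatureWith (cov s) (chartInv (𝓡 4) x₀ u) := by
  haveI := (g s).hasLeviCivita
  haveI := (chartPullback (𝓡 4) (g s) x₀).hasLeviCivita
  have h2 : (2 : ℕ∞ω) ≤ ∞ := WithTop.coe_le_coe.mpr le_top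
  rw [← OpensChart.scalarCurvature_eq_scalAt (val_chartPullback_eq_chartRep g x₀ s) u,
    (g s).scalarCurvature_comap contMDiff_pullbackBilin_holds (contMDiff_chartInv x₀)
      (injective_mfderiv_chartInv x₀) rfl u,
    scalarCurvatureWith, (hflow.isLeviCivita s hs).ricci_eq_ricci h2]
  rfl

/-- **The round defect read in the chart** (dimension `4`): for the Kulkarni–Nomizu array `A s` of
the chart components `G s = chartRep (𝓡 4) g x₀ s` and `a(s) = (6(T − s))⁻¹`,
`|Rm(G s) − a(s) A s|²(u) = Q − 2R/(3(T − s)) + 2/(3(T − s)²)` at `Φ u`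
(`tnormSq_rm4_sub_smul_ggKN` with `n = 4`, `tnormSq rm4 = |Rm|²`, `scalAt = R`).
[cite: Hamilton1982, §17, Lemma 17.5] -/
theorem roundDefect_chart_eq (hflow : IsRicciFlow g cov (Ico 0 T)) (hR : ∀ s ∈ Ico 0 T, (g s).IsRiemannian)
    {P : ℝ → M → ℝ}
    (hP : ∀ s x, P s x = (g s).curvNormSqWith (cov s) x
      - 2 * (g s).scalarCurvatureWith (cov s) x / (3 * (T - s)) + 2 / (3 * (T - s) ^ 2))
    (x₀ : M) {A : ℝ → (EuclideanSpace ℝ (Fin 4)) → (Fin 4 → Fin (finrank ℝ (EuclideanSpace ℝ (Fin 4)))) → ℝ}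
    (hA : ∀ s y J, A s y J =
      chartRep (𝓡 4) g x₀ s y (finBasis ℝ (EuclideanSpace ℝ (Fin 4)) (J 0)) (finBasis ℝ (EuclideanSpace ℝ (Fin 4)) (J 3))
        * chartRep (𝓡 4) g x₀ s y (finBasis ℝ (EuclideanSpace ℝ (Fin 4)) (J 1)) (finBasis ℝ (EuclideanSpace ℝ (Fin 4)) (J 2))
      - chartRep (𝓡 4) g x₀ s y (finBasis ℝ (EuclideanSpace ℝ (Fin 4)) (J 0)) (finBasis ℝ (EuclideanSpace ℝ (Fin 4)) (J 2))
        * chartRep (𝓡 4) g x₀ s y (finBasis ℝ (EuclideanSpace ℝ (Fin 4)) (J 1)) (finBasis ℝ (EuclideanSpace ℝ (Fin 4)) (J 3)))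
    {s : ℝ} (hs : s ∈ Ico 0 T) (u : chartTarget (𝓡 4) x₀) :
    P s (chartInv (𝓡 4) x₀ u) = tnormSq (chartRep (𝓡 4) g x₀ s) (finBasis ℝ (EuclideanSpace ℝ (Fin 4)))
      (rm4 (chartRep (𝓡 4) g x₀ s) (finBasis ℝ (EuclideanSpace ℝ (Fin 4))) - (6 * (T - s))⁻¹ • A s) u := by
  have hGs : IsMetricOn (chartRep (𝓡 4) g x₀ s) (extChartAt (𝓡 4) x₀).target := isMetricOn_chartRep g x₀ s
  have hsy := hGs.symm u u.2
  have hpos : ∀ v : (EuclideanSpace ℝ (Fin 4)), v ≠ 0 → 0 < chartRep (𝓡 4) g x₀ s u v v := fun v hv ↦ chartRep_pos (hR s hs) x₀ u v hv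
  have hn : (Fintype.card (Fin (finrank ℝ (EuclideanSpace ℝ (Fin 4)))) : ℝ) = 4 := by
    rw [Fintype.card_fin, finrank_euclideanSpace_fin]
    norm_num
  have hTs : T - s ≠ 0 := sub_ne_zero.2 (ne_of_gt hs.2)
  rw [tnormSq_rm4_sub_smul_ggKN (finBasis ℝ (EuclideanSpace ℝ (Fin 4))) (hA s) hsy hpos, hn,
    hGs.tnormSq_rm4_eq_rmNormSqAt (finBasis ℝ (EuclideanSpace ℝ (Fin 4))) u.2 hpos,
    ← curvNormSqWith_chartInv_eq (hflow.isLeviCivita s hs) x₀ u, scalAt_chartRep_eq_of hflow x₀ hs u, hP]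
  field_simp
  ring

/-- **The round defect `P(t, ·)` is `C^∞` on `M`** at times of the flow (its chart representative
is the smooth coordinate function `|Rm − a A|²`). [cite: Topping2006, §1.2.3] -/
theorem roundDefect_contMDiffAt (hT : 0 < T) (hflow : IsRicciFlow g cov (Ico 0 T))
    (hR : ∀ s ∈ Ico 0 T, (g s).IsRiemannian) {P : ℝ → M → ℝ}
    (hP : ∀ s x, P s x = (g s).curvNormSqWith (cov s) x
      - 2 * (g s).scalarCurvatureWith (cov s) x / (3 * (T - s)) + 2 / (3 * (T - s) ^ 2))
    {t : ℝ} (ht : t ∈ Ico 0 T) (x : M) : ContMDiffAt (𝓡 4) 𝓘(ℝ, ℝ) ∞ (P t) x := by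
  have hS : UniqueDiffOn ℝ (Ico 0 T) := uniqueDiffOn_Ico 0 T
  have hS' : Ico 0 T ⊆ closure (interior (Ico 0 T)) := by
    rw [interior_Ico, closure_Ioo hT.ne]
    exact Ico_subset_Icc_self
  set G := chartRep (𝓡 4) g x with hGdef
  set b := finBasis ℝ (EuclideanSpace ℝ (Fin 4)) with hbdef
  set A : ℝ → (EuclideanSpace ℝ (Fin 4)) → (Fin 4 → Fin (finrank ℝ (EuclideanSpace ℝ (Fin 4)))) → ℝ := fun s y J ↦
    G s y (b (J 0)) (b (J 3)) * G s y (b (J 1)) (b (J 2)) - G s y (b (J 0)) (b (J 2)) * G s y (b (J 1)) (b (J 3))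
    with hAdef
  have hA : ∀ s y J, A s y J =
      G s y (b (J 0)) (b (J 3)) * G s y (b (J 1)) (b (J 2)) - G s y (b (J 0)) (b (J 2)) * G s y (b (J 1)) (b (J 3)) :=
    fun _ _ _ ↦ rfl
  have hGt : IsMetricOn (G t) (extChartAt (𝓡 4) x).target :=
    ((hflow.isMetricFamilyOn_chartRep_of hS hS' x).isMetricOn t ht)
  have hDs : TSmoothOn (rm4 (G t) b - (6 * (T - t))⁻¹ • A t) (extChartAt (𝓡 4) x).target :=
    (hGt.tsmoothOn_rm4 b).sub ((hGt.tsmoothOn_ggKN b (hA t)).smul _)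
  exact contMDiffAt_of_chart_eq x (fun u ↦ roundDefect_chart_eq hflow hR hP x hA ht u)
    (hGt.contDiffOn_tnormSq hDs)

/-- **The evolution inequality of the round defect, in one chart** (Hamilton 1982, §17,
Thm. 17.6): for a Ricci flow of Riemannian metrics on `[0, T)`, `T > 0`, and a point `z₀` there is
`C ≥ 0` with `∂ₜP ≤ Δ_{g(t)}P − 2|∇Rm|² + C(Q + (T − t)⁻²)√|P| + C√Q|P|` at every `t ∈ [0, T)`
and every `z` in the source of the chart at `z₀`, `P = Q − 2R/(3(T − t)) + 2/(3(T − t)²)`: the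
coordinate inequality `derivWithin_tnormSq_roundDefect_le` with `a = (6(T − t))⁻¹`
(`|a'| = (T − t)⁻²/6`, `|a|√Q ≤ (Q + (T − t)⁻²)/2`), transported by the chart dictionary.
[cite: Hamilton1982, §17, Thm. 17.6] -/
theorem roundDefect_evolution_chart (hT : 0 < T) (hflow : IsRicciFlow g cov (Ico 0 T))
    (hR : ∀ s ∈ Ico 0 T, (g s).IsRiemannian) {P : ℝ → M → ℝ}
    (hP : ∀ s x, P s x = (g s).curvNormSqWith (cov s) x
      - 2 * (g s).scalarCurvatureWith (cov s) x / (3 * (T - s)) + 2 / (3 * (T - s) ^ 2)) (z₀ : M) :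
    ∃ C : ℝ, 0 ≤ C ∧ ∀ t ∈ Ico 0 T, ∀ z ∈ (extChartAt (𝓡 4) z₀).source,
      derivWithin (fun s ↦ P s z) (Ico 0 T) t ≤ (g t).laplaceBeltrami (P t) z
        - 2 * curvDerivNormSq (𝓡 4) g 1 t z
        + C * ((g t).curvNormSqWith (cov t) z + ((T - t) ^ 2)⁻¹) * Real.sqrt |P t z|
        + C * Real.sqrt ((g t).curvNormSqWith (cov t) z) * |P t z| := by
  have hS : UniqueDiffOn ℝ (Ico 0 T) := uniqueDiffOn_Ico 0 T
  have hS' : Ico 0 T ⊆ closure (interior (Ico 0 T)) := by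
    rw [interior_Ico, closure_Ioo hT.ne]
    exact Ico_subset_Icc_self
  have ht₀ : (0 : ℝ) ∈ Ico 0 T := ⟨le_rfl, hT⟩
  set G := chartRep (𝓡 4) g z₀ with hGdef
  set b := finBasis ℝ (EuclideanSpace ℝ (Fin 4)) with hbdef
  have hfam : IsMetricFamilyOn G (Ico 0 T) (extChartAt (𝓡 4) z₀).target :=
    hflow.isMetricFamilyOn_chartRep_of hS hS' z₀
  have hfl : ∀ s ∈ Ico 0 T, ∀ y ∈ (extChartAt (𝓡 4) z₀).target,
      tDeriv G (Ico 0 T) s y = (-2 : ℝ) • ricAt (G s) y :=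
    fun s hs y hy ↦ hflow.tDeriv_chartRep_eq_of hS hS' z₀ hs hy
  set A : ℝ → (EuclideanSpace ℝ (Fin 4)) → (Fin 4 → Fin (finrank ℝ (EuclideanSpace ℝ (Fin 4)))) → ℝ := fun s y J ↦
    G s y (b (J 0)) (b (J 3)) * G s y (b (J 1)) (b (J 2)) - G s y (b (J 0)) (b (J 2)) * G s y (b (J 1)) (b (J 3))
    with hAdef
  have hA : ∀ s y J, A s y J =
      G s y (b (J 0)) (b (J 3)) * G s y (b (J 1)) (b (J 2)) - G s y (b (J 0)) (b (J 2)) * G s y (b (J 1)) (b (J 3)) :=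
    fun _ _ _ ↦ rfl
  have h6 : ∀ s ∈ Ico 0 T, (6 : ℝ) * (T - s) ≠ 0 := fun s hs ↦
    mul_ne_zero (by norm_num) (sub_ne_zero.2 (ne_of_gt hs.2))
  have ha : ContDiffOn ℝ ∞ (fun s ↦ (6 * (T - s))⁻¹) (Ico 0 T) :=
    (contDiffOn_const.mul (contDiffOn_const.sub contDiffOn_id)).inv h6
  obtain ⟨C, hC0, hC⟩ := hfam.derivWithin_tnormSq_roundDefect_le b hfl hA ht₀ ha
  refine ⟨2 * C, by positivity, fun t ht z hz ↦ ?_⟩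
  have two : (2 : ℕ∞ω) ≤ ∞ := WithTop.coe_le_coe.mpr le_top
  have hy : extChartAt (𝓡 4) z₀ z ∈ (extChartAt (𝓡 4) z₀).target := (extChartAt (𝓡 4) z₀).map_source hz
  set u : chartTarget (𝓡 4) z₀ := ⟨extChartAt (𝓡 4) z₀ z, hy⟩ with hudef
  have hΦu : chartInv (𝓡 4) z₀ u = z := (extChartAt (𝓡 4) z₀).left_inv hz
  have hGt := hfam.isMetricOn t ht
  have hsy := hGt.symm u u.2
  have hpos : ∀ v : (EuclideanSpace ℝ (Fin 4)), v ≠ 0 → 0 < G t u v v := fun v hv ↦ chartRep_pos (hR t ht) z₀ u v hv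
  have hTt : 0 < T - t := sub_pos.2 ht.2
  -- (1) the coordinate inequality at `(u, t)`
  have key := hC t ht u u.2 hpos
  set Dt : (EuclideanSpace ℝ (Fin 4)) → (Fin 4 → Fin (finrank ℝ (EuclideanSpace ℝ (Fin 4)))) → ℝ := rm4 (G t) b - (6 * (T - t))⁻¹ • A t with hDt
  set u0 := tnormSq (G t) b (rm4 (G t) b) u with hu0
  set u1 := tnormSq (G t) b (curvD G b 1 t) u with hu1
  set uD := tnormSq (G t) b Dt u with huD
  have hu0n : 0 ≤ u0 := tnormSq_nonneg b hsy hpos _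
  have huDn : 0 ≤ uD := tnormSq_nonneg b hsy hpos _
  -- (2) the dictionary
  have hfun : ∀ s ∈ Ico 0 T, P s z = tnormSq (G s) b (rm4 (G s) b - (6 * (T - s))⁻¹ • A s) u := by
    intro s hs
    have h := roundDefect_chart_eq hflow hR hP z₀ hA hs u
    rwa [hΦu] at h
  have hPtz : P t z = uD := hfun t ht
  have hF1 : curvDerivNormSq (𝓡 4) g 1 t z = u1 := curvDerivNormSq_eq_chart (hR t ht) hz 1
  have hQ : (g t).curvNormSqWith (cov t) z = u0 := by
    rw [← hΦu, curvNormSqWith_chartInv_eq (hflow.isLeviCivita t ht) z₀ u]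
    exact (hGt.tnormSq_rm4_eq_rmNormSqAt b u.2 hpos).symm
  -- (3) the Laplacian
  haveI := (g t).hasLeviCivita
  haveI := (chartPullback (𝓡 4) (g t) z₀).hasLeviCivita
  have hGv := val_chartPullback_eq_chartRep g z₀ t
  have hDts : TSmoothOn Dt (extChartAt (𝓡 4) z₀).target :=
    (hGt.tsmoothOn_rm4 b).sub ((hGt.tsmoothOn_ggKN b (hA t)).smul _)
  have hrep : ∀ u' : chartTarget (𝓡 4) z₀, (P t ∘ chartInv (𝓡 4) z₀) u' = tnormSq (G t) b Dt u' :=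
    fun u' ↦ roundDefect_chart_eq hflow hR hP z₀ hA ht u'
  have hΦc : ContDiffAt ℝ 2 (tnormSq (G t) b Dt) (u : (EuclideanSpace ℝ (Fin 4))) :=
    ((hGt.contDiffOn_tnormSq hDts).contDiffAt ((isOpen_extChartAt_target z₀).mem_nhds u.2)).of_le two
  have hfsmooth : ContMDiffAt (𝓡 4) 𝓘(ℝ, ℝ) 2 (P t) (chartInv (𝓡 4) z₀ u) :=
    (roundDefect_contMDiffAt hT hflow hR hP ht _).of_le two
  have hlap : lapAt (G t) (tnormSq (G t) b Dt) u = (g t).laplaceBeltrami (P t) z := by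
    rw [← OpensChart.dalembertian_eq_lapAt hGv u hrep hΦc,
      (g t).dalembertian_comap contMDiff_pullbackBilin_holds (contMDiff_chartInv z₀)
        (injective_mfderiv_chartInv z₀) rfl hfsmooth, hΦu, laplaceBeltrami_eq_dalembertian]
  -- (4) the coefficient `a(t) = (6(T − t))⁻¹`
  have hah : HasDerivAt (fun s ↦ (6 * (T - s))⁻¹) (-(6 * -1) / (6 * (T - t)) ^ 2) t :=
    (((hasDerivAt_id' t).const_sub T).const_mul 6).inv (h6 t ht)
  have ha'v : derivWithin (fun s ↦ (6 * (T - s))⁻¹) (Ico 0 T) t = ((T - t) ^ 2)⁻¹ / 6 := by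
    rw [hah.hasDerivWithinAt.derivWithin (hS t ht)]
    field_simp
  have hw2n : 0 ≤ ((T - t) ^ 2)⁻¹ := by positivity
  have ha'le : |derivWithin (fun s ↦ (6 * (T - s))⁻¹) (Ico 0 T) t| ≤ ((T - t) ^ 2)⁻¹ := by
    rw [ha'v, abs_of_nonneg (by positivity)]
    linarith
  have hale : |(6 * (T - t))⁻¹| * Real.sqrt u0 ≤ u0 + ((T - t) ^ 2)⁻¹ := by
    rw [abs_of_pos (by positivity)]
    have hsq : Real.sqrt u0 ^ 2 = u0 := Real.sq_sqrt hu0n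
    have hcmp : ((6 * (T - t))⁻¹) ^ 2 ≤ ((T - t) ^ 2)⁻¹ := by
      rw [mul_inv, mul_pow, ← inv_pow]
      nlinarith [sq_nonneg (T - t)⁻¹]
    nlinarith [sq_nonneg ((6 * (T - t))⁻¹ - Real.sqrt u0), Real.sqrt_nonneg u0]
  have hsqD : 0 ≤ Real.sqrt uD := Real.sqrt_nonneg _
  have hcoef : u0 + |derivWithin (fun s ↦ (6 * (T - s))⁻¹) (Ico 0 T) t| + |(6 * (T - t))⁻¹| * Real.sqrt u0 ≤
      2 * (u0 + ((T - t) ^ 2)⁻¹) := by linarith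
  have hw1 := mul_le_mul_of_nonneg_right (mul_le_mul_of_nonneg_left hcoef hC0) hsqD
  have hw2 : 0 ≤ C * Real.sqrt u0 * uD := by positivity
  -- (5) assemble
  calc derivWithin (fun s ↦ P s z) (Ico 0 T) t
      = derivWithin (fun s ↦ tnormSq (G s) b (rm4 (G s) b - (6 * (T - s))⁻¹ • A s) u) (Ico 0 T) t :=
        derivWithin_congr (fun s hs ↦ hfun s hs) (hfun t ht)
    _ ≤ lapAt (G t) (tnormSq (G t) b Dt) u - 2 * u1
        + C * (u0 + |derivWithin (fun s ↦ (6 * (T - s))⁻¹) (Ico 0 T) t| + |(6 * (T - t))⁻¹| * Real.sqrt u0)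
          * Real.sqrt uD
        + C * Real.sqrt u0 * uD := key
    _ ≤ _ := by
        rw [← hlap, hF1, hQ, hPtz, abs_of_nonneg huDn]
        linarith

/-- **The evolution inequality of the round defect on a closed manifold**: one constant for all
`(t, z) ∈ [0, T) × M` (finitely many charts cover `M`). [cite: Hamilton1982, §17, Thm. 17.6] -/
theorem roundDefect_evolution_global [CompactSpace M] (hT : 0 < T) (hflow : IsRicciFlow g cov (Ico 0 T))
    (hR : ∀ s ∈ Ico 0 T, (g s).IsRiemannian) {P : ℝ → M → ℝ}
    (hP : ∀ s x, P s x = (g s).curvNormSqWith (cov s) x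
      - 2 * (g s).scalarCurvatureWith (cov s) x / (3 * (T - s)) + 2 / (3 * (T - s) ^ 2)) :
    ∃ C : ℝ, 0 ≤ C ∧ ∀ t ∈ Ico 0 T, ∀ z : M,
      derivWithin (fun s ↦ P s z) (Ico 0 T) t ≤ (g t).laplaceBeltrami (P t) z
        - 2 * curvDerivNormSq (𝓡 4) g 1 t z
        + C * ((g t).curvNormSqWith (cov t) z + ((T - t) ^ 2)⁻¹) * Real.sqrt |P t z|
        + C * Real.sqrt ((g t).curvNormSqWith (cov t) z) * |P t z| := by
  choose C hC0 hC using fun z₀ : M ↦ roundDefect_evolution_chart hT hflow hR hP z₀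
  obtain ⟨F, hcover⟩ := isCompact_univ.elim_finite_subcover (fun z₀ : M ↦ (extChartAt (𝓡 4) z₀).source)
    (fun z₀ ↦ isOpen_extChartAt_source z₀) fun z _ ↦ mem_iUnion.2 ⟨z, mem_extChartAt_source z⟩
  refine ⟨∑ z₀ ∈ F, C z₀, Finset.sum_nonneg fun z₀ _ ↦ hC0 z₀, fun t ht z ↦ ?_⟩
  obtain ⟨z₀, hz₀F, hz⟩ : ∃ z₀ ∈ F, z ∈ (extChartAt (𝓡 4) z₀).source := by
    simpa only [mem_iUnion, exists_prop] using hcover (mem_univ z)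
  have hle : C z₀ ≤ ∑ z₁ ∈ F, C z₁ := Finset.single_le_sum (fun z₁ _ ↦ hC0 z₁) hz₀F
  have h := hC z₀ t ht z hz
  have hQ0 : 0 ≤ (g t).curvNormSqWith (cov t) z := by
    rw [← curvDerivNormSq_zero_eq (hR t ht) (hflow.isLeviCivita t ht) z]
    exact curvDerivNormSq_nonneg (hR t ht) 0 z
  have hA : 0 ≤ ((g t).curvNormSqWith (cov t) z + ((T - t) ^ 2)⁻¹) * Real.sqrt |P t z| :=
    mul_nonneg (add_nonneg hQ0 (by positivity)) (Real.sqrt_nonneg _)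
  have hB : 0 ≤ Real.sqrt ((g t).curvNormSqWith (cov t) z) * |P t z| :=
    mul_nonneg (Real.sqrt_nonneg _) (abs_nonneg _)
  nlinarith [mul_le_mul_of_nonneg_right hle hA, mul_le_mul_of_nonneg_right hle hB]

end Manifold

/-- **Hamilton 1982, §17 (Thm. 17.6): the evolution inequality of the round defect along a Ricci
flow on a closed smooth 4-manifold.** For a Ricci flow `(g, cov)` of Riemannian metrics on
`[0, T)`, `T > 0`, on a closed 4-manifold there is `C₂ ≥ 0` such that the round defect
`P = Q − 2R/(3(T − t)) + 2/(3(T − t)²)` (`Q = |Rm|² = curvNormSqWith`, `R = scalarCurvatureWith`;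
`P = |Rm − (T − t)⁻¹(g ⊙ g)/6|² ≥ 0`) satisfies, at every `(t, x) ∈ [0, T) × M`,
`∂ₜP ≤ Δ_{g(t)}P − 2|∇Rm|² + C₂(Q + (T − t)⁻²)√|P| + C₂√Q |P|`
(`∂ₜ` within `[0, T)`, `|∇Rm|² = curvDerivNormSq (𝓡 4) g 1`, `Δ = laplaceBeltrami`): the reaction
term of the tensor heat equation vanishes to first order at the round tensor. Registered helper
S2 of `stub_smoothRoundLimit`. [cite: Hamilton1982, §17, Thm. 17.6] [cite: Topping2006, Prop. 3.2.10] -/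
theorem helper_roundDefect_evolution : ∀ (M : Type) [TopologicalSpace M] [T2Space M] [SecondCountableTopology M] [ChartedSpace (EuclideanSpace ℝ (Fin 4)) M] [IsManifold (𝓡 4) ∞ M] [CompactSpace M] (g : ℝ → PseudoRiemannianMetric (𝓡 4) ∞ (EuclideanSpace ℝ (Fin 4)) (TangentSpace (𝓡 4) : M → Type _)) (cov : ℝ → CovariantDerivative (𝓡 4) (EuclideanSpace ℝ (Fin 4)) (TangentSpace (𝓡 4) : M → Type _)) (T : ℝ), 0 < T → IsRicciFlow g cov (Ico 0 T) → (∀ t ∈ Ico 0 T, (g t).IsRiemannian) → ∃ C₂ : ℝ, 0 ≤ C₂ ∧ ∀ t ∈ Ico 0 T, ∀ x : M, derivWithin (fun s ↦ ((g s).curvNormSqWith (cov s) x - 2 * (g s).scalarCurvatureWith (cov s) x / (3 * (T - s)) + 2 / (3 * (T - s) ^ 2))) (Ico 0 T) t ≤ (g t).laplaceBeltrami (fun y ↦ (g t).curvNormSqWith (cov t) y - 2 * (g t).scalarCurvatureWith (cov t) y / (3 * (T - t)) + 2 / (3 * (T - t) ^ 2)) x - 2 * curvDerivNormSq (𝓡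 4) g 1 t x + C₂ * ((g t).curvNormSqWith (cov t) x + ((T - t) ^ 2)⁻¹) * Real.sqrt |((g t).curvNormSqWith (cov t) x - 2 * (g t).scalarCurvatureWith (cov t) x / (3 * (T - t)) + 2 / (3 * (T - t) ^ 2))| + C₂ * Real.sqrt ((g t).curvNormSqWith (cov t) x) * |((g t).curvNormSqWith (cov t) x - 2 * (g t).scalarCurvatureWith (cov t) x / (3 * (T - t)) + 2 / (3 * (T - t) ^ 2))| := by
  intro M _ _ _ _ _ _ g cov T hT hflow hR
  obtain ⟨C, hC0, hC⟩ := roundDefect_evolution_global (g := g) (cov := cov) hT hflow hR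
    (P := fun s x ↦ (g s).curvNormSqWith (cov s) x
      - 2 * (g s).scalarCurvatureWith (cov s) x / (3 * (T - s)) + 2 / (3 * (T - s) ^ 2))
    (fun _ _ ↦ rfl)
  exact ⟨C, hC0, fun t ht x ↦ hC t ht x⟩

end Summit.SmoothPoincare4.SmoothPoincare4.Theorems.MargerinRails

end
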